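import Summits.HodgeConjecture.HodgeConjecture.Theorems.F0P3PNullMapIsCocycle
import Summits.HodgeConjecture.HodgeConjecture.Theorems.F0P3bStubT6gPNullGeneration
import HarnessLib

/-!
# FLOOR-0 P3 — rung-1 brick S0: the ARCHIMEDEAN HALVES of E2′₀ and (E)h as theorems about typed null VALUE MAPS on an
# abstract irreducible `(𝔤, K)`-module of `U(α, β)` ∕ `U(2,1)`

Cell hodgecm-mathlib, FLOOR 0, crux item H413 = stmt-HodgeConjecture-24833; integrator brief F0P3-plan (g0) 2026-08-30T23:59:10Z
(«S0: independent of D4∕F2; uses only ★»).  PROOF lane (no `def`); author F0P3-p03 (g2).  A **typed-`δ` null value map** on a pair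
datum `(ρK, ρ𝔤)` of `U(α, β)` is a real-linear `φ : 𝔤 → V` with (h0) `φ(𝔨) = 0`, (hK) `ρK(k) φ(X) = φ(Ad k X)`, (h𝔨)
`φ(⁅W, X⁆) = ρ(W) φ(X)` for `W ∈ 𝔨`, (hwt) `ρ(z₀) φ(X) = δi · φ(X)`, (hN) `ρ(x_s) φ(X) + δi · ρ(⁅z₀, x_s⁆) φ(X) = 0` on the frame —
exactly what the junction J1 (D4∕F1a: `M(P, ι)`) will hand over for the value map of a non-zero cotangent form of Hodge type
`(1,0)` (`δ = 1`) or `(0,1)` (`δ = −1`); the five conditions are carried as explicit hypotheses (no new definition).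
* §0 `exists_typedCochain_of_valueMap`: packaging as a `(𝔤, K)`-1-cochain of type `δ` with the same values and the
  cochain-level nullity (★ `F0P3PNullMapIsCocycle.exists_gkCochain_of_linearMap` + ★ `mem_upqType_iff`); `valueMap_smul`: the
  five conditions are stable under `φ ↦ c • φ`, `c ∈ ℂ` (so the value maps form a COMPLEX subspace).
* §1 (R1, E2′₀-arch, generic `U(α, β)`, hypotheses `hV` + `IsIrreducibleGK` only) `not_both_types_of_valueMaps`: no irreducible
  module carries a non-zero typed null value map of type `+1` AND one of type `−1` (★ J2 `typeClasses_ne_bot_of_linearMap` ×2 +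
  ★ T6a `F0P3bStubT6aDegOneTypePure.typeClasses_one_eq_bot_or`).
* §2 (R2, (E)h-arch, `U(2,1)`, hypotheses `hV` + `IsIrreducibleGK` only) `exists_smul_eq_of_valueMaps`: two typed-`δ` null value
  maps `φ`, `φ′` with `φ ≠ 0` satisfy `φ′ = c • φ` for a COMPLEX `c` (★ T6g (2) `stubT6g_holds`: the `δi`-eigenvectors lie in
  `span_ℂ f(𝔤)`; ★ T6k (2) `stubT6k_holds`: Schur on `𝔭^δ ≅ ℂ²`) — «a complex line»; `finrank_valueMaps_le_two`: every real
  subspace of typed-`δ` null value maps is finite of `finrank_ℝ ≤ 2` (for rung 1: with `valueMap_smul`, `finrank_ℂ ≤ 1`).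
No unitarity ∕ admissibility anywhere (the cohomological road via ★ T6b would need them; the value-map road does not).

References: Borel–Wallach, *Continuous cohomology, discrete subgroups, and representations of reductive groups*, AMS 2000, II §4,
VI Thm. 4.11 [BorelWallach2000]; Rogawski, *Automorphic representations of unitary groups in three variables*, Princeton 1990,
Prop. 15.2.1 (b), §15.3 [Rogawski1990]; Knapp–Vogan, *Cohomological induction and unitary representations*, 1995, §II.4 [KnappVogan1995].
HONEST LABEL: HC_CM is proved only modulo the printed citations until rung 0 closes; this file discharges none of them.
-/

-- Mathlib idiom (as in `GKModules`, `GKCohomology`, the `Upq*` files and the Lines file): commutator bracket on `Module.End`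
attribute [local instance 100] LieRing.ofAssociativeRing

set_option autoImplicit false
set_option linter.dupNamespace false

noncomputable section

namespace Summit.HodgeConjecture.HodgeConjecture.Cruxes.H413.F0P3ArchValueMapRigidity

open Literature.Algebra.Lie Literature.Algebra.Lie.ChevalleyEilenberg
open Literature.NumberTheory.Automorphic
open Literature.RepresentationTheory.BorelWallach2000
open Literature.RepresentationTheory.KonnoKonno2007 Literature.RepresentationTheory.KonnoKonno2007.RealDualPair
open Literature.RepresentationTheory.KonnoKonno2007.RealDualPair.UForm
open Summit.HodgeConjecture.HodgeConjecture.Cruxes.H413.F0P3bStubT6kU21PGeometry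
open Summit.HodgeConjecture.HodgeConjecture.Cruxes.H413.F0P3bGKPairGlue
open Summit.HodgeConjecture.HodgeConjecture.Cruxes.H413.F0P3bStubT6aDegOneTypePure
open Summit.HodgeConjecture.HodgeConjecture.Cruxes.H413.F0P3bStubT6gPNullGeneration
open Summit.HodgeConjecture.HodgeConjecture.Cruxes.H413.F0P3PNullMapIsCocycle

section Generic

variable {α β : Type} [Fintype α] [DecidableEq α] [Fintype β] [DecidableEq β]
  {V : Type} [AddCommGroup V] [Module ℂ V]
  (ρK : Representation ℂ (uFormGroup α β).maximalCompact V)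
  (ρ𝔤 : (uFormGroup α β).lie →ₗ⁅ℝ⁆ Module.End ℂ V)
  (hV : ∀ (k : (uFormGroup α β).maximalCompact) (X : (uFormGroup α β).lie), ρK k ∘ₗ ρ𝔤 X ∘ₗ ρK k⁻¹ =
    ρ𝔤 ((uFormGroup α β).Ad (Subgroup.inclusion (uFormGroup α β).maximalCompact_le_carrier k) X))

/-! ## §0 Packaging of a typed null value map as a typed `(𝔤, K)`-1-cochain; complex multiples -/

include hV in
/-- **A typed-`δ` null value map IS (the value function of) a `(𝔤, K)`-1-cochain of type `δ` with `𝔭^{−δ}`-null values**,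
non-zero when `φ ≠ 0`. [cite: BorelWallach2000, I §5.1 (1)–(3), II §4.2 (3)] -/
theorem exists_typedCochain_of_valueMap {δ : ℤ} (φ : (uFormGroup α β).lie →ₗ[ℝ] V)
    (h0 : ∀ W ∈ (uFormGroup α β).kInLie, φ W = 0)
    (hK : ∀ (k : (uFormGroup α β).maximalCompact) (X : (uFormGroup α β).lie),
      ρK k (φ X) = φ ((uFormGroup α β).Ad (Subgroup.inclusion (uFormGroup α β).maximalCompact_le_carrier k) X))
    (h𝔨 : ∀ W ∈ (uFormGroup α β).kInLie, ∀ X : (uFormGroup α β).lie, φ ⁅W, X⁆ = ρ𝔤 W (φ X))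
    (hwt : ∀ X : (uFormGroup α β).lie, ρ𝔤 (upqZ0 α β) (φ X) = ((δ : ℂ) * Complex.I) • φ X)
    (hN : ∀ (X : (uFormGroup α β).lie) (s : (α × β) × Fin 2),
      ρ𝔤 (upqPBasis s) (φ X) + ((δ : ℂ) * Complex.I) • ρ𝔤 ⁅upqZ0 α β, upqPBasis s⁆ (φ X) = 0) :
    ∃ f : Cochain ℝ (uFormGroup α β).lie (GKCarrier (uFormGroup α β) ρ𝔤) 1,
      f ∈ upqType ρK ρ𝔤 hV 1 δ ∧ (∀ X : (uFormGroup α β).lie, (f ![X] : V) = φ X) ∧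
      (∀ (Y : Fin 1 → (uFormGroup α β).lie) (s : (α × β) × Fin 2),
        ⁅upqPBasis s, f Y⁆ + ((δ : ℂ) * Complex.I) • ⁅⁅upqZ0 α β, upqPBasis s⁆, f Y⁆ = 0) ∧
      (φ ≠ 0 → f ≠ 0) := by
  obtain ⟨f, hfc, hf⟩ := exists_gkCochain_of_linearMap ρK ρ𝔤 hV φ h0 hK h𝔨
  have hfv : ∀ v : Fin 1 → (uFormGroup α β).lie, (f v : V) = φ (v 0) := fun v => by
    have e : v = ![v 0] := by funext i; fin_cases i; rfl
    rw [e]; exact hf (v 0)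
  refine ⟨f, (mem_upqType_iff ρK ρ𝔤 hV 1 δ f).2 ⟨hfc, fun v => by rw [hfv]; exact hwt (v 0)⟩, hf, fun Y s => ?_,
    fun hφ0 hf0 => hφ0 ?_⟩
  · rw [GKCarrier.bracket_def, GKCarrier.bracket_def, hfv]
    exact hN (Y 0) s
  · ext X
    rw [← hf X, hf0, AlternatingMap.zero_apply, LinearMap.zero_apply]
    rfl

/-- **Complex multiples of a typed-`δ` null value map are typed-`δ` null value maps** (all five conditions are
`ℂ`-linear in the values): the value maps form a complex subspace of `𝔤 →ₗ[ℝ] V`. [cite: BorelWallach2000, II §4.2 (3)] -/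
theorem valueMap_smul {δ : ℤ} (c : ℂ) (φ : (uFormGroup α β).lie →ₗ[ℝ] V)
    (h0 : ∀ W ∈ (uFormGroup α β).kInLie, φ W = 0)
    (hK : ∀ (k : (uFormGroup α β).maximalCompact) (X : (uFormGroup α β).lie),
      ρK k (φ X) = φ ((uFormGroup α β).Ad (Subgroup.inclusion (uFormGroup α β).maximalCompact_le_carrier k) X))
    (h𝔨 : ∀ W ∈ (uFormGroup α β).kInLie, ∀ X : (uFormGroup α β).lie, φ ⁅W, X⁆ = ρ𝔤 W (φ X))
    (hwt : ∀ X : (uFormGroup α β).lie, ρ𝔤 (upqZ0 α β) (φ X) = ((δ : ℂ) * Complex.I) • φ X)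
    (hN : ∀ (X : (uFormGroup α β).lie) (s : (α × β) × Fin 2),
      ρ𝔤 (upqPBasis s) (φ X) + ((δ : ℂ) * Complex.I) • ρ𝔤 ⁅upqZ0 α β, upqPBasis s⁆ (φ X) = 0) :
    (∀ W ∈ (uFormGroup α β).kInLie, (c • φ) W = 0) ∧
    (∀ (k : (uFormGroup α β).maximalCompact) (X : (uFormGroup α β).lie),
      ρK k ((c • φ) X) = (c • φ) ((uFormGroup α β).Ad (Subgroup.inclusion (uFormGroup α β).maximalCompact_le_carrier k) X)) ∧
    (∀ W ∈ (uFormGroup α β).kInLie, ∀ X : (uFormGroup α β).lie, (c • φ) ⁅W, X⁆ = ρ𝔤 W ((c • φ) X)) ∧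
    (∀ X : (uFormGroup α β).lie, ρ𝔤 (upqZ0 α β) ((c • φ) X) = ((δ : ℂ) * Complex.I) • (c • φ) X) ∧
    (∀ (X : (uFormGroup α β).lie) (s : (α × β) × Fin 2),
      ρ𝔤 (upqPBasis s) ((c • φ) X) + ((δ : ℂ) * Complex.I) • ρ𝔤 ⁅upqZ0 α β, upqPBasis s⁆ ((c • φ) X) = 0) := by
  refine ⟨fun W hW => ?_, fun k X => ?_, fun W hW X => ?_, fun X => ?_, fun X s => ?_⟩
  · rw [LinearMap.smul_apply, h0 W hW, smul_zero]
  · rw [LinearMap.smul_apply, LinearMap.smul_apply, map_smul, hK]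
  · rw [LinearMap.smul_apply, LinearMap.smul_apply, map_smul, h𝔨 W hW X]
  · rw [LinearMap.smul_apply, map_smul, hwt X, smul_comm]
  · rw [LinearMap.smul_apply, map_smul, map_smul, smul_comm _ c, ← smul_add, hN X s, smul_zero]

/-! ## §1 (R1) E2′₀ at the archimedean place: no irreducible module has typed null value maps of BOTH types -/

include hV in
/-- **E2′₀-arch (generic `U(α, β)`)**: an IRREDUCIBLE `(𝔤, K)`-module does not carry a non-zero typed null value map of
type `+1` together with one of type `−1` — each gives a non-zero `H¹_{±1}` (★ J2 `typeClasses_ne_bot_of_linearMap`),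
contradicting purity (★ T6a `typeClasses_one_eq_bot_or`).  No unitarity ∕ admissibility.
[cite: Rogawski1990, §15.3 ¶1, Prop. 15.2.1 (b); BorelWallach2000, VI Thm. 4.11] -/
theorem not_both_types_of_valueMaps (hirr : IsIrreducibleGK ρK ρ𝔤) (φp φm : (uFormGroup α β).lie →ₗ[ℝ] V)
    (hp0 : ∀ W ∈ (uFormGroup α β).kInLie, φp W = 0)
    (hpK : ∀ (k : (uFormGroup α β).maximalCompact) (X : (uFormGroup α β).lie),
      ρK k (φp X) = φp ((uFormGroup α β).Ad (Subgroup.inclusion (uFormGroup α β).maximalCompact_le_carrier k) X))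
    (hp𝔨 : ∀ W ∈ (uFormGroup α β).kInLie, ∀ X : (uFormGroup α β).lie, φp ⁅W, X⁆ = ρ𝔤 W (φp X))
    (hpwt : ∀ X : (uFormGroup α β).lie, ρ𝔤 (upqZ0 α β) (φp X) = Complex.I • φp X)
    (hpN : ∀ (X : (uFormGroup α β).lie) (s : (α × β) × Fin 2),
      ρ𝔤 (upqPBasis s) (φp X) + Complex.I • ρ𝔤 ⁅upqZ0 α β, upqPBasis s⁆ (φp X) = 0)
    (hm0 : ∀ W ∈ (uFormGroup α β).kInLie, φm W = 0)
    (hmK : ∀ (k : (uFormGroup α β).maximalCompact) (X : (uFormGroup α β).lie),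
      ρK k (φm X) = φm ((uFormGroup α β).Ad (Subgroup.inclusion (uFormGroup α β).maximalCompact_le_carrier k) X))
    (hm𝔨 : ∀ W ∈ (uFormGroup α β).kInLie, ∀ X : (uFormGroup α β).lie, φm ⁅W, X⁆ = ρ𝔤 W (φm X))
    (hmwt : ∀ X : (uFormGroup α β).lie, ρ𝔤 (upqZ0 α β) (φm X) = (-Complex.I) • φm X)
    (hmN : ∀ (X : (uFormGroup α β).lie) (s : (α × β) × Fin 2),
      ρ𝔤 (upqPBasis s) (φm X) + (-Complex.I) • ρ𝔤 ⁅upqZ0 α β, upqPBasis s⁆ (φm X) = 0)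
    (hp : φp ≠ 0) (hm : φm ≠ 0) : False := by
  have e1 : (((1 : ℤ) : ℂ) * Complex.I) = Complex.I := by rw [Int.cast_one, one_mul]
  have e2 : (((-1 : ℤ) : ℂ) * Complex.I) = -Complex.I := by rw [Int.cast_neg, Int.cast_one, neg_one_mul]
  have h1 : upqTypeClasses ρK ρ𝔤 hV 1 1 ≠ ⊥ :=
    typeClasses_ne_bot_of_linearMap ρK ρ𝔤 hV hirr (Or.inl rfl) φp hp hp0 hpK hp𝔨 (fun X => by rw [e1]; exact hpwt X)
      fun X s => by rw [e1]; exact hpN X s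
  have h2 : upqTypeClasses ρK ρ𝔤 hV 1 (-1) ≠ ⊥ :=
    typeClasses_ne_bot_of_linearMap ρK ρ𝔤 hV hirr (Or.inr rfl) φm hm hm0 hmK hm𝔨 (fun X => by rw [e2]; exact hmwt X)
      fun X s => by rw [e2]; exact hmN X s
  rcases typeClasses_one_eq_bot_or ρK ρ𝔤 hV hirr with h | h
  · exact h1 h
  · exact h2 h

end Generic

/-! ## §2 (R2) (E)h at the archimedean place, `U(2,1)`: the typed-`δ` null value maps form a complex line -/

section U21

variable {V : Type} [AddCommGroup V] [Module ℂ V]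
  (ρK : Representation ℂ (uFormGroup (Fin 2) (Fin 1)).maximalCompact V)
  (ρ𝔤 : (uFormGroup (Fin 2) (Fin 1)).lie →ₗ⁅ℝ⁆ Module.End ℂ V)
  (hV : ∀ (k : (uFormGroup (Fin 2) (Fin 1)).maximalCompact) (X : (uFormGroup (Fin 2) (Fin 1)).lie),
    ρK k ∘ₗ ρ𝔤 X ∘ₗ ρK k⁻¹ =
      ρ𝔤 ((uFormGroup (Fin 2) (Fin 1)).Ad (Subgroup.inclusion (uFormGroup (Fin 2) (Fin 1)).maximalCompact_le_carrier k) X))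

include hV in
/-- **(E)h-arch, `U(2,1)`: two typed-`δ` null value maps on an IRREDUCIBLE module are COMPLEX proportional** — the
values of `φ′` have `z₀`-weight `δi`, hence lie in `span_ℂ φ(𝔤)` (★ T6g (2)), and Schur on the `K`-module `𝔭^δ ≅ ℂ²`
(★ T6k (2)) makes `φ′` a complex multiple of `φ`.  No unitarity ∕ admissibility.
[cite: BorelWallach2000, VI Thm. 4.11 (3); Rogawski1990, Prop. 15.2.1 (b)] -/
theorem exists_smul_eq_of_valueMaps (hirr : IsIrreducibleGK ρK ρ𝔤) {δ : ℤ} (hδ : δ = 1 ∨ δ = -1)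
    (φ φ' : (uFormGroup (Fin 2) (Fin 1)).lie →ₗ[ℝ] V)
    (h0 : ∀ W ∈ (uFormGroup (Fin 2) (Fin 1)).kInLie, φ W = 0)
    (hK : ∀ (k : (uFormGroup (Fin 2) (Fin 1)).maximalCompact) (X : (uFormGroup (Fin 2) (Fin 1)).lie),
      ρK k (φ X) = φ ((uFormGroup (Fin 2) (Fin 1)).Ad (Subgroup.inclusion (uFormGroup (Fin 2) (Fin 1)).maximalCompact_le_carrier k) X))
    (h𝔨 : ∀ W ∈ (uFormGroup (Fin 2) (Fin 1)).kInLie, ∀ X : (uFormGroup (Fin 2) (Fin 1)).lie, φ ⁅W, X⁆ = ρ𝔤 W (φ X))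
    (hwt : ∀ X : (uFormGroup (Fin 2) (Fin 1)).lie, ρ𝔤 (upqZ0 (Fin 2) (Fin 1)) (φ X) = ((δ : ℂ) * Complex.I) • φ X)
    (hN : ∀ (X : (uFormGroup (Fin 2) (Fin 1)).lie) (s : (Fin 2 × Fin 1) × Fin 2),
      ρ𝔤 (upqPBasis s) (φ X) + ((δ : ℂ) * Complex.I) • ρ𝔤 ⁅upqZ0 (Fin 2) (Fin 1), upqPBasis s⁆ (φ X) = 0)
    (h0' : ∀ W ∈ (uFormGroup (Fin 2) (Fin 1)).kInLie, φ' W = 0)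
    (hK' : ∀ (k : (uFormGroup (Fin 2) (Fin 1)).maximalCompact) (X : (uFormGroup (Fin 2) (Fin 1)).lie),
      ρK k (φ' X) = φ' ((uFormGroup (Fin 2) (Fin 1)).Ad (Subgroup.inclusion (uFormGroup (Fin 2) (Fin 1)).maximalCompact_le_carrier k) X))
    (h𝔨' : ∀ W ∈ (uFormGroup (Fin 2) (Fin 1)).kInLie, ∀ X : (uFormGroup (Fin 2) (Fin 1)).lie, φ' ⁅W, X⁆ = ρ𝔤 W (φ' X))
    (hwt' : ∀ X : (uFormGroup (Fin 2) (Fin 1)).lie, ρ𝔤 (upqZ0 (Fin 2) (Fin 1)) (φ' X) = ((δ : ℂ) * Complex.I) • φ' X)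
    (hN' : ∀ (X : (uFormGroup (Fin 2) (Fin 1)).lie) (s : (Fin 2 × Fin 1) × Fin 2),
      ρ𝔤 (upqPBasis s) (φ' X) + ((δ : ℂ) * Complex.I) • ρ𝔤 ⁅upqZ0 (Fin 2) (Fin 1), upqPBasis s⁆ (φ' X) = 0)
    (hφ0 : φ ≠ 0) : ∃ c : ℂ, φ' = c • φ := by
  obtain ⟨f, hft, hfX, hfN, hf0⟩ := exists_typedCochain_of_valueMap ρK ρ𝔤 hV φ h0 hK h𝔨 hwt hN
  obtain ⟨f', hf't, hf'X, -, -⟩ := exists_typedCochain_of_valueMap ρK ρ𝔤 hV φ' h0' hK' h𝔨' hwt' hN'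
  have hW := (stubT6g_holds (Fin 2) (Fin 1) V ρK ρ𝔤 hV hirr δ hδ f hft (hf0 hφ0) hfN).2
  have hf'w := ((mem_upqType_iff ρK ρ𝔤 hV 1 δ f').1 hf't).2
  have hvals : ∀ X : (uFormGroup (Fin 2) (Fin 1)).lie,
      f' ![X] ∈ Submodule.span ℂ (Set.range fun Y : (uFormGroup (Fin 2) (Fin 1)).lie => f ![Y]) :=
    fun X => hW (f' ![X]) (hf'w ![X])
  obtain ⟨c, hc⟩ := (stubT6k_holds V ρK ρ𝔤 hV δ hδ f f' hft hf't (hf0 hφ0)).2 hvals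
  refine ⟨c, LinearMap.ext fun X => ?_⟩
  rw [LinearMap.smul_apply, ← hf'X X, ← hfX X]
  exact hc X

include hV in
/-- **(E)h-arch, dimension form, `U(2,1)`**: every real subspace of typed-`δ` null value maps on an IRREDUCIBLE module is
finite-dimensional of `finrank_ℝ ≤ 2` (it lies in the real plane `ℂ • φ₀` of any non-zero member; with `valueMap_smul`,
«a complex line»). [cite: BorelWallach2000, VI Thm. 4.11 (3); Rogawski1990, Prop. 15.2.1 (b)] -/
theorem finrank_valueMaps_le_two (hirr : IsIrreducibleGK ρK ρ𝔤) {δ : ℤ} (hδ : δ = 1 ∨ δ = -1)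
    (S : Submodule ℝ ((uFormGroup (Fin 2) (Fin 1)).lie →ₗ[ℝ] V))
    (h0 : ∀ φ ∈ S, ∀ W ∈ (uFormGroup (Fin 2) (Fin 1)).kInLie, φ W = 0)
    (hK : ∀ φ ∈ S, ∀ (k : (uFormGroup (Fin 2) (Fin 1)).maximalCompact) (X : (uFormGroup (Fin 2) (Fin 1)).lie),
      ρK k (φ X) = φ ((uFormGroup (Fin 2) (Fin 1)).Ad (Subgroup.inclusion (uFormGroup (Fin 2) (Fin 1)).maximalCompact_le_carrier k) X))
    (h𝔨 : ∀ φ ∈ S, ∀ W ∈ (uFormGroup (Fin 2) (Fin 1)).kInLie, ∀ X : (uFormGroup (Fin 2) (Fin 1)).lie, φ ⁅W, X⁆ = ρ𝔤 W (φ X))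
    (hwt : ∀ φ ∈ S, ∀ X : (uFormGroup (Fin 2) (Fin 1)).lie, ρ𝔤 (upqZ0 (Fin 2) (Fin 1)) (φ X) = ((δ : ℂ) * Complex.I) • φ X)
    (hN : ∀ φ ∈ S, ∀ (X : (uFormGroup (Fin 2) (Fin 1)).lie) (s : (Fin 2 × Fin 1) × Fin 2),
      ρ𝔤 (upqPBasis s) (φ X) + ((δ : ℂ) * Complex.I) • ρ𝔤 ⁅upqZ0 (Fin 2) (Fin 1), upqPBasis s⁆ (φ X) = 0) :
    Module.Finite ℝ S ∧ Module.finrank ℝ S ≤ 2 := by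
  by_cases hex : ∃ φ₀ ∈ S, φ₀ ≠ 0
  · obtain ⟨φ₀, hφ₀S, hφ₀⟩ := hex
    let Φ : ℂ →ₗ[ℝ] ((uFormGroup (Fin 2) (Fin 1)).lie →ₗ[ℝ] V) :=
      (LinearMap.toSpanSingleton ℂ ((uFormGroup (Fin 2) (Fin 1)).lie →ₗ[ℝ] V) φ₀).restrictScalars ℝ
    have hle : S ≤ LinearMap.range Φ := by
      intro φ hφ
      obtain ⟨c, hc⟩ := exists_smul_eq_of_valueMaps ρK ρ𝔤 hV hirr hδ φ₀ φ (h0 φ₀ hφ₀S) (hK φ₀ hφ₀S) (h𝔨 φ₀ hφ₀S)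
        (hwt φ₀ hφ₀S) (hN φ₀ hφ₀S) (h0 φ hφ) (hK φ hφ) (h𝔨 φ hφ) (hwt φ hφ) (hN φ hφ) hφ₀
      exact ⟨c, by rw [LinearMap.restrictScalars_apply, LinearMap.toSpanSingleton_apply, hc]⟩
    have h2 : Module.finrank ℝ ↥(LinearMap.range Φ) ≤ 2 :=
      (LinearMap.finrank_range_le Φ).trans_eq Complex.finrank_real_complex
    haveI : Module.Finite ℝ S := Submodule.finiteDimensional_of_le hle
    exact ⟨inferInstance, (Submodule.finrank_mono hle).trans h2⟩
  · have hS : S = ⊥ := by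
      rw [Submodule.eq_bot_iff]
      intro φ hφ
      by_contra hφ0
      exact hex ⟨φ, hφ, hφ0⟩
    rw [hS]
    exact ⟨inferInstance, by rw [finrank_bot]; norm_num⟩

end U21

end Summit.HodgeConjecture.HodgeConjecture.Cruxes.H413.F0P3ArchValueMapRigidity

end
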